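import Mathlib
import HarnessLib
import Summits.HubbardSuperconductivity.HubbardSuperconductivity.Theorems.KLProgrammeKLRegimeSectorSliceDefectPairFat
import Summits.HubbardSuperconductivity.HubbardSuperconductivity.Theorems.KLProgrammeKLRegimeSectorSliceIncrPairSectional
import Summits.HubbardSuperconductivity.HubbardSuperconductivity.Theorems.KLProgrammeKLRegimeSectorSliceFatSections

/-!
# K3 VL child `KLRegimeVolumeLimitV17F2` (stmt-HubbardSuperconductivity-20440), located item #23 «W2-HALF-VL» / «W2H-SEC-COV», brick 3: the SECTIONAL
# (fixed-time, spatially weighted) per-pair bound of the sectorised slice DEFECT `S(F̃)ᵀ·(C^{K′}_{(Λ,Λ′]} − C^{K}_{(Λ,Λ′]})·S(F̃)` for the fat family — ε-FREE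

Cell `gate-hubbard-kl`, seat p3 (g13), lead of #23.  The fixed-time twin of k3c4-p2's `sliceDefectPairWt_bgmFat_le` (`…SectorSliceDefectPairFat`, p593xxx):
SAME section hypotheses and data (p3's `bgmFatPairWt_data`, the band increment `P₀ … P₃`, cutoff `B₁ … B₄`), the closed amplitude `AΔ` WITHOUT its time
summand (no `s₀`-condition, no `Λ′ < π(2M−5)/β`), the support count replaced by the two SECTION counts of the first factor `F̃_ω` (p3 g11
`card_timeSections_bgmFat_le`, `card_spaceSection_bgmFat_le`); core = brick 1 `sliceIncrPairWt_charSum_sectional_le` (p604651).  Result, for EVERY time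
difference `z₁` and ALL positive rates: `Σ_{z₂} (1 + s₁|z̃₂|₁)·‖S[(βL²)⁻²F̃_ωF̃_{ω′}(Ψ̂[K′] − Ψ̂[K])](z₁,z₂)‖ ≤ (Λ_mβ/π + 3)·(√W·√(24·L²·N̄_cell)·AΔ)` —
no `2M`: the input `hT` of `secRowWt_sliceCT_covSub_le` (p603183) for the sectional COVARIANCE piece of the #23 telescope.  Everything is proved; no definitions; nothing asserts any stub, K3, VL or superconductivity. [cite: BenfattoGiulianiMastropietro2006, §2.8 (2.81), §3 (3.2)–(3.8)]
-/

noncomputable section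

namespace Summit.HubbardSuperconductivity.HubbardSuperconductivity.Theorems.TorusFourierL2

set_option linter.dupNamespace false -- summit = problem name (single-conjunct summit), D-0017

open Set Finset Literature.MathematicalPhysics.QuantumLattice Literature.MathematicalPhysics.QuantumLattice.BandSectorCounting
open Literature.MathematicalPhysics.QuantumLattice.FermiRG Literature.Probability.LatticeModels Literature.Analysis.SpecialFunctions
open Summit.HubbardSuperconductivity.HubbardSuperconductivity.Theorems.DispersionFlow
open Summit.HubbardSuperconductivity.HubbardSuperconductivity.Theorems.KLRegimeSplit
open Summit.HubbardSuperconductivity.HubbardSuperconductivity.Theorems.KLProgrammeLegKernels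
open Summit.HubbardSuperconductivity.HubbardSuperconductivity.Theorems.PerturbedFermiCurve
open scoped Real Nat


/-! ## The uniform weighted per-pair bound of the slice DEFECT for the fat family, closed form, arbitrary positive rates -/

section PairBound

open Classical

variable {L M : ℕ} [NeZero L] [NeZero M] {a b : ℝ} (B : BandBounds a b) {K K' : TrigPolyC4v} {A : ℝ}
  (hA : ∀ p : Momentum, ∀ j ≤ 2, ‖iteratedFDeriv ℝ j (frameShift K) p‖ ≤ A) (hADt : 2 * A < B.Dtmin)
  {μ e₀ z β : ℝ} (he : 0 < e₀) (hz : 0 < z) (hz1 : z ≤ 1) (hgap : e₀ + A + z ^ 2 < -μ) (h3 : e₀ + A - μ ≤ 3)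
  (hlo : a ≤ μ - A - e₀) (hhi : μ + A + e₀ ≤ b) (hβ : 0 < β) (hρA : 4 * A < 2 * B.rhomin)
  (m : ℕ) (hMm : klScale e₀ m * β < π * (2 * M - 5))
  {d : ℝ} (hd : 0 ≤ d) (hd1 : ∀ u, |deriv (bgmCutoffSq e₀) u| ≤ d) (hd2 : ∀ u, |iteratedDeriv 2 (bgmCutoffSq e₀) u| ≤ d)
  (hd3 : ∀ u, |iteratedDeriv 3 (bgmCutoffSq e₀) u| ≤ d)
  {A₃ a₃ : ℝ} (hA3 : ∀ p : Momentum, ‖iteratedFDeriv ℝ 3 (frameShift K) p‖ ≤ A₃) (ha3 : A₃ * klScale e₀ m ^ 2 ≤ a₃)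
  {Ba : ℝ} (hB0 : 0 ≤ Ba)
  (hB : ∀ (i : ℕ), i ≤ 2 → ∀ (n : ℕ) (ω : ℤ) (θ₀ : ℝ) (q w : Fin 2 → ℝ) (t : ℝ) {r₀ : ℝ}, 0 < r₀ →
    r₀ ≤ ‖momToComplex (q + t • w)‖ → |sectorRelAngle θ₀ (q + t • w)| < π →
    ‖iteratedDeriv i (fun t : ℝ => sectorWeightCirc n ω (polarAngle (q + t • w))) t‖ ≤
      (2 : ℕ)! * Ba * ((1 + (sectorWidth n)⁻¹ * (2 : ℕ)!) * ‖momToComplex w‖ / r₀) ^ i)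
  {Ba3 : ℝ} (hB30 : 0 ≤ Ba3)
  (hB3 : ∀ (i : ℕ), i ≤ 3 → ∀ (n : ℕ) (ω : ℤ) (θ₀ : ℝ) (q w : Fin 2 → ℝ) (t : ℝ) {r₀ : ℝ}, 0 < r₀ →
    r₀ ≤ ‖momToComplex (q + t • w)‖ → |sectorRelAngle θ₀ (q + t • w)| < π →
    ‖iteratedDeriv i (fun t : ℝ => sectorWeightCirc n ω (polarAngle (q + t • w))) t‖ ≤
      (3 : ℕ)! * Ba3 * ((1 + (sectorWidth n)⁻¹ * (3 : ℕ)!) * ‖momToComplex w‖ / r₀) ^ i)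
  -- the slice and the Euclidean frame data of the propagator side (frame `K`)
  {Λ Λ' : ℝ} (hΛ : 0 < Λ) (hΛΛ' : Λ ≤ Λ')
  {K₁ K₂ K₃ : ℝ} (hK₁ : ∀ p, ‖fderiv ℝ (frameLevel μ K) p‖ ≤ K₁) (hK₂ : ∀ p, ‖iteratedFDeriv ℝ 2 (frameLevel μ K) p‖ ≤ K₂)
  (hK₃ : ∀ p, ‖iteratedFDeriv ℝ 3 (frameLevel μ K) p‖ ≤ K₃)
  {B₁ B₂ B₃ B₄ : ℝ} (hB₁ : ∀ x, |deriv salmhoferCutoff x| ≤ B₁) (hB₂ : ∀ x, |deriv (deriv salmhoferCutoff) x| ≤ B₂)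
  (hB₃ : ∀ x, |deriv (deriv (deriv salmhoferCutoff)) x| ≤ B₃) (hB₄ : ∀ x, |deriv (deriv (deriv (deriv salmhoferCutoff))) x| ≤ B₄)
  -- the band increment `e_{K′} − e_K` of the second frame
  {P₀ P₁ P₂ P₃ : ℝ} (hv₀ : ∀ p, |frameLevel μ K' p - frameLevel μ K p| ≤ P₀)
  (hv₁ : ∀ p, ‖fderiv ℝ (fun p => frameLevel μ K' p - frameLevel μ K p) p‖ ≤ P₁)
  (hv₂ : ∀ p, ‖iteratedFDeriv ℝ 2 (fun p => frameLevel μ K' p - frameLevel μ K p) p‖ ≤ P₂)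
  (hv₃ : ∀ p, ‖iteratedFDeriv ℝ 3 (fun p => frameLevel μ K' p - frameLevel μ K p) p‖ ≤ P₃)
  -- tangent resolution, zone margin for the steps, far-region radius
  {Nr : ℝ} (hNr : 2 ≤ Nr) (hLz : 3 * |2 * π / L| * (Nr + 1 / 2) ≤ z) {R₀ : ℕ} (hR₀ : 2 * (2 * Nr + 1) * (R₀ : ℝ) < L)
  -- abbreviations (instantiate with `rfl`)
  {ℓ₁ ℓ ρf G₁ G₂ G₃ Kp wsi τt Ae1 Ae2 An1 An2 Av1 Av2 κ₃F : ℝ}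
  (hℓ₁ : ℓ₁ = 2 * π / L) (hℓ : ℓ = 2 * π / L * (Nr + 1 / 2))
  (hρf : ρf = (klScale e₀ m + B.smax * B.Dtmin * (3 * sectorWidth (m + 1) / 4)) / (B.Dtmin - 2 * A) +
    π * Real.sqrt 2 * (1 + (4 + 2 * A) / (B.Dtmin - 2 * A)) * sectorWidth (m + 1))
  (hG₁ : G₁ = d * e₀ ^ 2 * 1 + 1 * (d * e₀ ^ 2)) (hG₂ : G₂ = d * e₀ ^ 4 * 1 + 2 * (d * e₀ ^ 2) * (d * e₀ ^ 2) + 1 * (d * e₀ ^ 4))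
  (hG₃ : G₃ = d * e₀ ^ 6 * 1 + 3 * (d * e₀ ^ 4) * (d * e₀ ^ 2) + 3 * (d * e₀ ^ 2) * (d * e₀ ^ 4) + 1 * (d * e₀ ^ 6))
  (hκ₃F : κ₃F = (8 * G₃ + 12 * G₂) * (4 + 2 * A) ^ 3 + (12 * G₂ + 6 * G₁) * (4 + 2 * A) * (4 + 4 * A) * e₀ +
      2 * G₁ * (4 * e₀ ^ 2 + 8 * a₃) +
      216 * 9 * Ba3 * ((4 * G₂ + 2 * G₁) * (4 + 2 * A) ^ 2 * (2 * e₀) + 2 * G₁ * (4 + 4 * A) * e₀ * (2 * e₀)) +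
      216 * 9 * G₁ * (4 + 2 * A) * (12 * Ba3 + 72 * Ba3 ^ 2) * (2 * e₀) ^ 2 + 216 * 9 * (12 * Ba3 + 216 * Ba3 ^ 2) * (2 * e₀) ^ 3)
  (hKp : Kp = 4 + 4 * A) (hwsi : wsi = (sectorWidth (m + 1))⁻¹)
  (hτt : τt = |2 * π / L| * (4 + 2 * A) + K₂ * (Real.sqrt 2 * ρf) * (Real.sqrt 2 * ℓ))
  (hAe1 : Ae1 = 2 * G₁ * ((4 + 2 * A) * ℓ₁ + Kp * (ρf + 2 * ℓ₁) * ℓ₁) / klScale e₀ m * 1 + 1 * 1 * (9 * (4 * Ba * ((1 + 2 * wsi) * (2 * ℓ₁)))))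
  (hAe2 : Ae2 = ((4 * G₂ + 2 * G₁) * ((4 + 2 * A) * ℓ₁ + Kp * (ρf + 2 * ℓ₁) * ℓ₁) ^ 2 / klScale e₀ m ^ 2 + 2 * G₁ * (Kp * ℓ₁ ^ 2) / klScale e₀ m) * 1 +
    4 * G₁ * ((4 + 2 * A) * ℓ₁ + Kp * (ρf + 2 * ℓ₁) * ℓ₁) / klScale e₀ m * (9 * (4 * Ba * ((1 + 2 * wsi) * (2 * ℓ₁)))) +
    1 * 1 * (9 * (4 * Ba * ((1 + 2 * wsi) * (2 * ℓ₁)) ^ 2 + 8 * Ba ^ 2 * ((1 + 2 * wsi) * (2 * ℓ₁)) ^ 2)))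
  (hAn1 : An1 = 2 * G₁ * ((4 + 2 * A) * ℓ + Kp * (ρf + 2 * ℓ) * ℓ) / klScale e₀ m * 1 + 1 * 1 * (9 * (4 * Ba * ((1 + 2 * wsi) * (2 * ℓ)))))
  (hAn2 : An2 = ((4 * G₂ + 2 * G₁) * ((4 + 2 * A) * ℓ + Kp * (ρf + 2 * ℓ) * ℓ) ^ 2 / klScale e₀ m ^ 2 + 2 * G₁ * (Kp * ℓ ^ 2) / klScale e₀ m) * 1 +
    4 * G₁ * ((4 + 2 * A) * ℓ + Kp * (ρf + 2 * ℓ) * ℓ) / klScale e₀ m * (9 * (4 * Ba * ((1 + 2 * wsi) * (2 * ℓ)))) +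
    1 * 1 * (9 * (4 * Ba * ((1 + 2 * wsi) * (2 * ℓ)) ^ 2 + 8 * Ba ^ 2 * ((1 + 2 * wsi) * (2 * ℓ)) ^ 2)))
  (hAv1 : Av1 = 2 * G₁ * (|2 * π / L| * (4 + 2 * A) + Kp * (ρf + 2 * ℓ) * ℓ) / klScale e₀ m * 1 + 1 * 1 * (9 * (4 * Ba * ((1 + 2 * wsi) * (2 * ℓ)))))
  (hAv2 : Av2 = ((4 * G₂ + 2 * G₁) * (|2 * π / L| * (4 + 2 * A) + Kp * (ρf + 2 * ℓ) * ℓ) ^ 2 / klScale e₀ m ^ 2 + 2 * G₁ * (Kp * ℓ ^ 2) / klScale e₀ m) * 1 +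
    4 * G₁ * (|2 * π / L| * (4 + 2 * A) + Kp * (ρf + 2 * ℓ) * ℓ) / klScale e₀ m * (9 * (4 * Ba * ((1 + 2 * wsi) * (2 * ℓ)))) +
    1 * 1 * (9 * (4 * Ba * ((1 + 2 * wsi) * (2 * ℓ)) ^ 2 + 8 * Ba ^ 2 * ((1 + 2 * wsi) * (2 * ℓ)) ^ 2)))
  -- the increment polynomials and the closed amplitude (instantiate with `rfl`)
  {X₀ X₁ X₂ X₃ Tt : ℝ}
  (hX₀ : X₀ = (16 * B₁ + 16) * (β * (L : ℝ) ^ 2) / Λ ^ 2 * P₀)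
  (hX₁ : X₁ = (32 * B₂ + 144 * B₁ + 128) * (β * (L : ℝ) ^ 2) / Λ ^ 3 * P₀ * (K₁ + P₁) + (16 * B₁ + 16) * (β * (L : ℝ) ^ 2) / Λ ^ 2 * P₁)
  (hX₂ : X₂ = (64 * B₃ + 480 * B₂ + 1728 * B₁ + 1536) * (β * (L : ℝ) ^ 2) / Λ ^ 4 * P₀ * (K₁ + P₁) ^ 2 +
    (32 * B₂ + 144 * B₁ + 128) * (β * (L : ℝ) ^ 2) / Λ ^ 3 * (P₁ * (2 * K₁ + P₁)) +
    ((32 * B₂ + 144 * B₁ + 128) * (β * (L : ℝ) ^ 2) / Λ ^ 3 * P₀ * (K₂ + P₂) + (16 * B₁ + 16) * (β * (L : ℝ) ^ 2) / Λ ^ 2 * P₂))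
  (hX₃ : X₃ = (128 * B₄ + 1408 * B₃ + 7776 * B₂ + 27648 * B₁ + 24576) * (β * (L : ℝ) ^ 2) / Λ ^ 5 * P₀ * (K₁ + P₁) ^ 3 +
    (64 * B₃ + 480 * B₂ + 1728 * B₁ + 1536) * (β * (L : ℝ) ^ 2) / Λ ^ 4 * (P₁ * (3 * K₁ ^ 2 + 3 * K₁ * P₁ + P₁ ^ 2)) +
    3 * ((64 * B₃ + 480 * B₂ + 1728 * B₁ + 1536) * (β * (L : ℝ) ^ 2) / Λ ^ 4 * P₀ * ((K₁ + P₁) * (K₂ + P₂)) +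
      (32 * B₂ + 144 * B₁ + 128) * (β * (L : ℝ) ^ 2) / Λ ^ 3 * (K₁ * P₂ + P₁ * K₂ + P₁ * P₂)) +
    ((32 * B₂ + 144 * B₁ + 128) * (β * (L : ℝ) ^ 2) / Λ ^ 3 * P₀ * (K₃ + P₃) + (16 * B₁ + 16) * (β * (L : ℝ) ^ 2) / Λ ^ 2 * P₃))
  (hTt : Tt = (1 / (β * (L : ℝ) ^ 2)) ^ 2 *
    (1 * ((2 * π / β) ^ 3 * ((128 * B₄ + 1216 * B₃ + 6912 * B₂ + 26112 * B₁ + 24576) * (β * (L : ℝ) ^ 2) / Λ ^ 5 * P₀)) +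
      3 * ((2 * G₁ * |2 * π / β| * 1 / klScale e₀ m) * ((2 * π / β) ^ 2 * ((64 * B₃ + 416 * B₂ + 1600 * B₁ + 1536) * (β * (L : ℝ) ^ 2) / Λ ^ 4 * P₀))) +
      3 * (((4 * G₂ + 2 * G₁) * (2 * π / β) ^ 2 * 1 / klScale e₀ m ^ 2) * ((2 * π / β) * ((32 * B₂ + 128 * B₁ + 128) * (β * (L : ℝ) ^ 2) / Λ ^ 3 * P₀))) +
      ((8 * G₃ + 12 * G₂) * |2 * π / β| ^ 3 * 1 / klScale e₀ m ^ 3) * ((16 * B₁ + 16) * (β * (L : ℝ) ^ 2) / Λ ^ 2 * P₀)))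

include B hA hADt he hz hz1 hgap h3 hlo hhi hβ hρA hMm hd hd1 hd2 hd3 hA3 ha3 hB0 hB hB30 hB3 hΛ hΛΛ' hK₁ hK₂ hK₃ hB₁ hB₂ hB₃ hB₄
  hv₀ hv₁ hv₂ hv₃ hNr hLz hR₀ hℓ₁ hℓ hρf hG₁ hG₂ hG₃ hκ₃F hKp hwsi hτt hAe1 hAe2 hAn1 hAn2 hAv1 hAv2 hX₀ hX₁ hX₂ hX₃ in
set_option maxHeartbeats 4000000 in
/-- **The uniform SECTIONAL per-pair bound of the slice DEFECT for the fat family, closed form, arbitrary positive rates** (see the module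
docstring; fixed-time twin of `sliceDefectPairWt_bgmFat_le`; one disclosed heartbeat raise: statement size). [cite: BenfattoGiulianiMastropietro2006, §2.8 (2.81), §3 (3.2)–(3.8)] -/
theorem sliceDefectPairWt_bgmFat_sectional_le (ω ω' : Fin (sectorCount (m + 1))) (v : Fin 2 → ℤ) (hv : v ≠ 0)
    (hvj : ∀ j, |(v j : ℝ)| ≤ Nr + 1 / 2) (hvlen : Nr - 1 ≤ Real.sqrt ((v 0 : ℝ) ^ 2 + (v 1 : ℝ) ^ 2))
    (hvtan : |fderiv ℝ (fun p : Fin 2 → ℝ => frameLevel μ K (WithLp.toLp 2 p)) (klFermiPoint μ K (sectorCenter (m + 1) (ω : ℕ)))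
      (fun j => 2 * π / L * (v j : ℝ))| ≤ |2 * π / L| * (4 + 2 * A))
    {s₀ s₁ s₂ s₃ s₃' : ℝ} (hs₀ : 0 < s₀) (hs₁ : 0 < s₁) (hs₂ : 0 < s₂) (hs₃ : 0 < s₃) (hs₃' : 0 < s₃')
    {AΔ : ℝ} (hAΔ : AΔ = (1 / (β * (L : ℝ) ^ 2)) ^ 2 * X₀ +
      (1 / (β * (L : ℝ) ^ 2)) ^ 2 * ((Real.sqrt 2 * ℓ₁) ^ 3 * X₃ + 3 * (Ae1 * ((Real.sqrt 2 * ℓ₁) ^ 2 * X₂)) +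
        3 * (Ae2 * ((Real.sqrt 2 * ℓ₁) * X₁)) + κ₃F * ℓ₁ ^ 3 / klScale e₀ m ^ 3 * X₀) / (4 / (s₁ * L)) ^ 3 +
      (1 / (β * (L : ℝ) ^ 2)) ^ 2 * ((Real.sqrt 2 * ℓ) ^ 3 * X₃ + 3 * (An1 * ((Real.sqrt 2 * ℓ) ^ 2 * X₂)) +
        3 * (An2 * ((Real.sqrt 2 * ℓ) * X₁)) + κ₃F * ℓ ^ 3 / klScale e₀ m ^ 3 * X₀) / (4 / (s₂ * L)) ^ 3 +
      (1 / (β * (L : ℝ) ^ 2)) ^ 2 * ((Real.sqrt 2 * ℓ) ^ 2 * X₂ + 2 * (Av1 * ((Real.sqrt 2 * ℓ) * X₁)) + Av2 * X₀) / (4 / (s₃ * L)) ^ 2 +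
      (1 / (β * (L : ℝ) ^ 2)) ^ 2 * ((Real.sqrt 2 * ℓ) ^ 3 * X₃ + 3 * (Av1 * ((Real.sqrt 2 * ℓ) ^ 2 * X₂)) +
        3 * (Av2 * ((Real.sqrt 2 * ℓ) * X₁)) + κ₃F * ℓ ^ 3 / klScale e₀ m ^ 3 * X₀) / (4 / (s₃' * L)) ^ 3) :
    ∀ z₁ : TorusSite 1 (2 * M), ∑ z₂ : TorusSite 2 L,
        (1 + s₁ * |(((z₂ 0).valMinAbs : ℤ) : ℝ)| + s₁ * |(((z₂ 1).valMinAbs : ℤ) : ℝ)|) *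
        ‖∑ q : TorusSite 1 (2 * M) × TorusSite 2 L, (torusChar q.1 z₁ * torusChar q.2 z₂) •
          ((((1 / (β * (L : ℝ) ^ 2) : ℝ) : ℂ) ^ 2 *
            (bgmFatMultiplier L M e₀ β (nambuXiCT L μ K) (m + 1) ω (⟨(q.1 0).val, ZMod.val_lt (q.1 0)⟩, q.2) *
              bgmFatMultiplier L M e₀ β (nambuXiCT L μ K) (m + 1) ω' (⟨(q.1 0).val, ZMod.val_lt (q.1 0)⟩, q.2) *
              (sliceSymbolFnXi (β * (L : ℝ) ^ 2) 0 Λ Λ' (matsubaraFreq β M ⟨(q.1 0).val, ZMod.val_lt (q.1 0)⟩) (nambuXiCT L μ K' q.2) -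
                sliceSymbolFnXi (β * (L : ℝ) ^ 2) 0 Λ Λ' (matsubaraFreq β M ⟨(q.1 0).val, ZMod.val_lt (q.1 0)⟩) (nambuXiCT L μ K q.2)))))‖ ≤
      (klScale e₀ m * β / π + 3) * (Real.sqrt (524288 * (1 / s₀ + 1) *
          ((1 + 2 * Real.sqrt 2 * s₁ / (s₂ * (Nr - 1)) + 2 * Real.sqrt 2 * s₁ / (s₃' * (Nr - 1))) ^ 2 *
            ((2 * Real.sqrt 2 / (s₂ * (Nr - 1)) + 2) * (2 * Real.sqrt 2 / (s₃ * (Nr - 1)) + 2))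
            + (1 / s₁ + 1) ^ 2 / (1 + s₁ * R₀))) *
        Real.sqrt (24 * (L : ℝ) ^ 2 *
            ((Real.sqrt 2 * L * ((klScale e₀ m + (4 + 4 * A) * ρf ^ 2) / (2 * B.rhomin - 4 * A)) / π + 2) *
              (Real.sqrt 2 * L * (2 * ρf) / π + 2))) * AΔ) := by
  have hL : (0 : ℝ) < L := Nat.cast_pos.2 (Nat.pos_of_ne_zero (NeZero.ne L))
  have hMpos : (0 : ℝ) < ((2 * M : ℕ) : ℝ) := by
    have : 0 < M := Nat.pos_of_ne_zero (NeZero.ne M)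
    exact_mod_cast (by omega : 0 < 2 * M)
  have hπ := Real.pi_pos
  have hΛm : 0 < klScale e₀ m := by rw [klScale]; positivity
  have hA0 : 0 ≤ A := (norm_nonneg _).trans (hA 0 0 (by norm_num))
  have hK10 : 0 ≤ K₁ := le_trans (norm_nonneg _) (hK₁ 0)
  have hK20 : 0 ≤ K₂ := le_trans (norm_nonneg _) (hK₂ 0)
  have hK30 : 0 ≤ K₃ := le_trans (norm_nonneg _) (hK₃ 0)
  have hP0 : 0 ≤ P₀ := (abs_nonneg _).trans (hv₀ 0)
  have hP1 : 0 ≤ P₁ := le_trans (norm_nonneg _) (hv₁ 0)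
  have hP2 : 0 ≤ P₂ := le_trans (norm_nonneg _) (hv₂ 0)
  have hP3 : 0 ≤ P₃ := le_trans (norm_nonneg _) (hv₃ 0)
  have hB10 : 0 ≤ B₁ := (abs_nonneg _).trans (hB₁ 0)
  have hB20 : 0 ≤ B₂ := (abs_nonneg _).trans (hB₂ 0)
  have hB30' : 0 ≤ B₃ := (abs_nonneg _).trans (hB₃ 0)
  have hB40 : 0 ≤ B₄ := (abs_nonneg _).trans (hB₄ 0)
  have hρf0 : 0 ≤ ρf := by
    have hDt : 0 < B.Dtmin - 2 * A := by linarith only [hADt]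
    rw [hρf]; have := B.smax_pos; have := B.Dtmin_pos; have := sectorWidth_pos (m + 1); positivity
  have hℓ₁0 : 0 < ℓ₁ := by rw [hℓ₁]; positivity
  have hNr0 : (0:ℝ) < Nr + 1 / 2 := by linarith only [hNr]
  have hℓ0 : 0 < ℓ := by rw [hℓ]; positivity
  have hKp0 : 0 ≤ Kp := by rw [hKp]; positivity
  have hwsi0 : 0 ≤ wsi := by rw [hwsi]; have := sectorWidth_pos (m + 1); positivity
  have hG₁0 : 0 ≤ G₁ := by rw [hG₁]; positivity
  have hG₂0 : 0 ≤ G₂ := by rw [hG₂]; positivity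
  have hG₃0 : 0 ≤ G₃ := by rw [hG₃]; positivity
  have hκ₃F0 : 0 ≤ κ₃F := by
    rw [hκ₃F]
    have ha30 : 0 ≤ a₃ := le_trans (by have := le_trans (norm_nonneg _) (hA3 0); positivity) ha3
    positivity
  have hcβ : 0 ≤ β * (L : ℝ) ^ 2 := by positivity
  have hc0 : (0 : ℝ) ≤ (1 / (β * (L : ℝ) ^ 2)) ^ 2 := by positivity
  have hAe10 : 0 ≤ Ae1 := by rw [hAe1]; positivity
  have hAe20 : 0 ≤ Ae2 := by rw [hAe2]; positivity
  have hAn10 : 0 ≤ An1 := by rw [hAn1]; positivity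
  have hAn20 : 0 ≤ An2 := by rw [hAn2]; positivity
  have hAv10 : 0 ≤ Av1 := by rw [hAv1]; positivity
  have hAv20 : 0 ≤ Av2 := by rw [hAv2]; positivity
  have hX₀0 : 0 ≤ X₀ := by rw [hX₀]; positivity
  have hX₁0 : 0 ≤ X₁ := by rw [hX₁]; positivity
  have hX₂0 : 0 ≤ X₂ := by rw [hX₂]; positivity
  have hX₃0 : 0 ≤ X₃ := by rw [hX₃]; positivity
  have hA3ℓ₁ : 0 ≤ κ₃F * ℓ₁ ^ 3 / klScale e₀ m ^ 3 := by positivity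
  have hA3ℓ : 0 ≤ κ₃F * ℓ ^ 3 / klScale e₀ m ^ 3 := by positivity
  have hs2 : 0 ≤ Real.sqrt 2 := Real.sqrt_nonneg 2
  -- the multiplier data of the fat pair (p3)
  obtain ⟨Gs, hGsdef⟩ : ∃ Gs : TorusSite 1 (2 * M) × TorusSite 2 L → ℂ, Gs = fun q =>
    bgmFatMultiplier L M e₀ β (nambuXiCT L μ K) (m + 1) ω (⟨(q.1 0).val, ZMod.val_lt (q.1 0)⟩, q.2) *
      bgmFatMultiplier L M e₀ β (nambuXiCT L μ K) (m + 1) ω' (⟨(q.1 0).val, ZMod.val_lt (q.1 0)⟩, q.2) := ⟨_, rfl⟩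
  obtain ⟨hM0, -, -, -, -, haxes, hnormal, htangent, -⟩ :=
    bgmFatPairWt_data B hA hADt he hz hz1 hgap h3 hlo hhi hβ hρA m hMm hd hd1 hd2 hd3 hA3 ha3 hB0 hB hB30 hB3 hK₂ hNr hLz
      hℓ₁ hℓ hρf hG₁ hG₂ hG₃ hκ₃F hKp hwsi hτt hAe1 hAe2 hAn1 hAn2 hAv1 hAv2 ω ω' v hvj hvtan Gs hGsdef
  -- the two section counts of the fat pair (through the first factor `F̃_ω`)
  have hsuppT : (((univ : Finset (TorusSite 1 (2 * M))).filter fun q₁ => ∃ k : TorusSite 2 L, Gs (q₁, k) ≠ 0).card : ℝ) ≤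
      klScale e₀ m * β / π + 3 := by
    refine le_trans ?_ (card_timeSections_bgmFat_le (L := L) (M := M) (μ := μ) he hβ K m ω)
    exact_mod_cast Finset.card_le_card fun q₁ hq₁ => by
      rw [mem_filter] at hq₁ ⊢
      obtain ⟨k, hk⟩ := hq₁.2
      exact ⟨mem_univ _, k, fun h0 => hk (by rw [hGsdef]; dsimp only; rw [h0, zero_mul])⟩
  have hsuppS : ∀ q₁ : TorusSite 1 (2 * M), (((univ : Finset (TorusSite 2 L)).filter fun k => Gs (q₁, k) ≠ 0).card : ℝ) ≤
      (Real.sqrt 2 * L * ((klScale e₀ m + (4 + 4 * A) * ρf ^ 2) / (2 * B.rhomin - 4 * A)) / π + 2) *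
        (Real.sqrt 2 * L * (2 * ρf) / π + 2) := by
    intro q₁
    have h := card_spaceSection_bgmFat_le (L := L) (M := M) (β := β) B hA hADt he hz hz1 hgap hlo hhi hρA m ω ⟨(q₁ 0).val, ZMod.val_lt (q₁ 0)⟩
    rw [← hρf] at h
    refine le_trans ?_ h
    exact_mod_cast Finset.card_le_card fun k hk => by
      rw [mem_filter] at hk ⊢
      exact ⟨mem_univ _, fun h0 => hk.2 (by rw [hGsdef]; dsimp only; rw [h0, zero_mul])⟩
  obtain ⟨Nt, hNt, hNtle⟩ : ∃ Nt : ℕ, ((univ : Finset (TorusSite 1 (2 * M))).filter fun q₁ => ∃ k : TorusSite 2 L, Gs (q₁, k) ≠ 0).card ≤ Nt ∧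
      (Nt : ℝ) ≤ klScale e₀ m * β / π + 3 := ⟨_, le_rfl, hsuppT⟩
  obtain ⟨Nsp, hNsp, hNsple⟩ : ∃ Nsp : ℕ, (∀ q₁ : TorusSite 1 (2 * M), ((univ : Finset (TorusSite 2 L)).filter fun k => Gs (q₁, k) ≠ 0).card ≤ Nsp) ∧
      (Nsp : ℝ) ≤ (Real.sqrt 2 * L * ((klScale e₀ m + (4 + 4 * A) * ρf ^ 2) / (2 * B.rhomin - 4 * A)) / π + 2) *
        (Real.sqrt 2 * L * (2 * ρf) / π + 2) := by
    refine ⟨univ.sup fun q₁ : TorusSite 1 (2 * M) => ((univ : Finset (TorusSite 2 L)).filter fun k => Gs (q₁, k) ≠ 0).card,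
      fun q₁ => le_sup (f := fun q₁ : TorusSite 1 (2 * M) => ((univ : Finset (TorusSite 2 L)).filter fun k => Gs (q₁, k) ≠ 0).card) (mem_univ q₁), ?_⟩
    obtain ⟨q₁, -, hq₁⟩ := exists_mem_eq_sup (univ : Finset (TorusSite 1 (2 * M))) univ_nonempty
      (fun q₁ : TorusSite 1 (2 * M) => ((univ : Finset (TorusSite 2 L)).filter fun k => Gs (q₁, k) ≠ 0).card)
    rw [hq₁]; exact hsuppS q₁
  -- the step norms
  have hnorm_u : ∀ (u : Fin 2 → ℤ) (b : ℝ), (∀ j, |(u j : ℝ)| ≤ b) → ‖(fun j => 2 * π / L * (u j : ℝ))‖ ≤ 2 * π / L * b := by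
    intro u b hb
    refine (pi_norm_le_iff_of_nonneg (by
      have : 0 ≤ b := (abs_nonneg _).trans (hb 0); positivity)).2 fun j => ?_
    rw [Real.norm_eq_abs, abs_mul, abs_of_pos (by positivity : (0:ℝ) < 2 * π / L)]
    exact mul_le_mul_of_nonneg_left (hb j) (by positivity)
  have hvb : ‖(fun j => 2 * π / L * (v j : ℝ))‖ ≤ ℓ := by rw [hℓ]; exact hnorm_u v _ hvj
  have hne : ‖(WithLp.toLp 2 (fun i => 2 * π / L * (v i : ℝ)) : EuclideanSpace ℝ (Fin 2))‖ ≤ Real.sqrt 2 * ℓ :=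
    (norm_toLp_le _).trans (mul_le_mul_of_nonneg_left hvb (Real.sqrt_nonneg 2))
  have hne_axis : ∀ i : Fin 2, ‖(WithLp.toLp 2 (fun j => 2 * π / L * ((Pi.single i (1 : ℤ) : Fin 2 → ℤ) j : ℝ)) : EuclideanSpace ℝ (Fin 2))‖ ≤
      Real.sqrt 2 * ℓ₁ := by
    intro i
    refine (norm_toLp_le _).trans (mul_le_mul_of_nonneg_left ?_ (Real.sqrt_nonneg 2))
    rw [hℓ₁]
    have hub : ∀ j, |(((Pi.single i (1 : ℤ) : Fin 2 → ℤ) j : ℤ) : ℝ)| ≤ 1 := by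
      intro j; by_cases h : j = i
      · subst h; simp
      · simp [h]
    have := hnorm_u (Pi.single i 1) 1 hub; simpa using this
  have hne_n : ‖(WithLp.toLp 2 (fun j => 2 * π / L * ((![-v 1, v 0] : Fin 2 → ℤ) j : ℝ)) : EuclideanSpace ℝ (Fin 2))‖ ≤ Real.sqrt 2 * ℓ := by
    refine (norm_toLp_le _).trans (mul_le_mul_of_nonneg_left ?_ (Real.sqrt_nonneg 2))
    rw [hℓ]
    refine hnorm_u _ _ fun j => ?_
    fin_cases j
    · show |(((-v 1 : ℤ) : ℤ) : ℝ)| ≤ Nr + 1 / 2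
      rw [Int.cast_neg, abs_neg]; exact hvj 1
    · exact hvj 0
  have hR₀' : 2 * (|v 0| + |v 1|) * (R₀ : ℤ) < L := by
    have h0 := hvj 0; have h1 := hvj 1
    have : (2 * (|(v 0 : ℝ)| + |(v 1 : ℝ)|)) * (R₀ : ℝ) ≤ 2 * (2 * Nr + 1) * (R₀ : ℝ) :=
      mul_le_mul_of_nonneg_right (by linarith only [h0, h1]) (Nat.cast_nonneg _)
    have : ((2 * (|v 0| + |v 1|) * (R₀ : ℤ) : ℤ) : ℝ) < (L : ℝ) := by
      push_cast; rw [← Int.cast_abs, ← Int.cast_abs]; push_cast; linarith only [this, hR₀]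
    exact_mod_cast this
  -- the rate factors
  have hr1pos : 0 < (4 / (s₁ * L)) ^ 3 := by positivity
  have hr2pos : 0 < (4 / (s₂ * L)) ^ 3 := by positivity
  have hr3pos : 0 < (4 / (s₃ * L)) ^ 2 := by positivity
  have hr3'pos : 0 < (4 / (s₃' * L)) ^ 3 := by positivity
  -- the six summands of `AΔ` and their nonnegativity
  set SA : ℝ := (1 / (β * (L : ℝ) ^ 2)) ^ 2 * X₀ with hSA
  set E : ℝ := (1 / (β * (L : ℝ) ^ 2)) ^ 2 * ((Real.sqrt 2 * ℓ₁) ^ 3 * X₃ + 3 * (Ae1 * ((Real.sqrt 2 * ℓ₁) ^ 2 * X₂)) +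
        3 * (Ae2 * ((Real.sqrt 2 * ℓ₁) * X₁)) + κ₃F * ℓ₁ ^ 3 / klScale e₀ m ^ 3 * X₀) with hE
  set Nn : ℝ := (1 / (β * (L : ℝ) ^ 2)) ^ 2 * ((Real.sqrt 2 * ℓ) ^ 3 * X₃ + 3 * (An1 * ((Real.sqrt 2 * ℓ) ^ 2 * X₂)) +
        3 * (An2 * ((Real.sqrt 2 * ℓ) * X₁)) + κ₃F * ℓ ^ 3 / klScale e₀ m ^ 3 * X₀) with hNn
  set V2 : ℝ := (1 / (β * (L : ℝ) ^ 2)) ^ 2 * ((Real.sqrt 2 * ℓ) ^ 2 * X₂ + 2 * (Av1 * ((Real.sqrt 2 * ℓ) * X₁)) + Av2 * X₀) with hV2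
  set V3 : ℝ := (1 / (β * (L : ℝ) ^ 2)) ^ 2 * ((Real.sqrt 2 * ℓ) ^ 3 * X₃ + 3 * (Av1 * ((Real.sqrt 2 * ℓ) ^ 2 * X₂)) +
        3 * (Av2 * ((Real.sqrt 2 * ℓ) * X₁)) + κ₃F * ℓ ^ 3 / klScale e₀ m ^ 3 * X₀) with hV3
  have hSA0 : 0 ≤ SA := by positivity
  have hE0 : 0 ≤ E := by positivity
  have hNn0 : 0 ≤ Nn := by positivity
  have hV20 : 0 ≤ V2 := by positivity
  have hV30 : 0 ≤ V3 := by positivity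
  have hAΔ' : AΔ = SA + E / (4 / (s₁ * L)) ^ 3 + Nn / (4 / (s₂ * L)) ^ 3 + V2 / (4 / (s₃ * L)) ^ 2 + V3 / (4 / (s₃' * L)) ^ 3 := by
    rw [hAΔ]
  have hE' : 0 ≤ E / (4 / (s₁ * L)) ^ 3 := by positivity
  have hNn' : 0 ≤ Nn / (4 / (s₂ * L)) ^ 3 := by positivity
  have hV2' : 0 ≤ V2 / (4 / (s₃ * L)) ^ 2 := by positivity
  have hV3' : 0 ≤ V3 / (4 / (s₃' * L)) ^ 3 := by positivity
  -- each summand is dominated by `AΔ` times its rate factor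
  have hA : (1 / (β * (L : ℝ) ^ 2)) ^ 2 * ((16 * B₁ + 16) * (β * (L : ℝ) ^ 2) / Λ ^ 2 * P₀) ≤ AΔ := by
    rw [hAΔ', ← hX₀]; linarith
  have hTE : E ≤ AΔ * (4 / (s₁ * L)) ^ 3 := by
    refine le_mul_of_div_le' hr1pos ?_
    rw [hAΔ']; linarith
  have hTN : Nn ≤ AΔ * (4 / (s₂ * L)) ^ 3 := by
    refine le_mul_of_div_le' hr2pos ?_
    rw [hAΔ']; linarith
  have hTV2 : V2 ≤ AΔ * (4 / (s₃ * L)) ^ 2 := by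
    refine le_mul_of_div_le' hr3pos ?_
    rw [hAΔ']; linarith
  have hTV3 : V3 ≤ AΔ * (4 / (s₃' * L)) ^ 3 := by
    refine le_mul_of_div_le' hr3'pos ?_
    rw [hAΔ']; linarith
  -- the sectional increment pair lemma
  have hmain := sliceIncrPairWt_charSum_sectional_le (K := K) (K' := K') hβ hΛ hΛΛ' hK₁ hK₂ hK₃ hv₀ hv₁ hv₂ hv₃ hB₁ hB₂ hB₃ hB₄ Gs hM0
    v hv hR₀' hNt hNsp
    (fun _ => Ae1) (fun _ => Ae2) (fun _ => κ₃F * ℓ₁ ^ 3 / klScale e₀ m ^ 3) (fun _ => hAe10) (fun _ => hAe20) (fun _ => hA3ℓ₁)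
    (fun q i => (haxes i).1 q) (fun q i => (haxes i).2.1 q) (fun q i => (haxes i).2.2 q)
    hAn10 hAn20 hA3ℓ hnormal.1 hnormal.2.1 hnormal.2.2 hAv10 hAv20 hA3ℓ htangent.1 htangent.2.1 htangent.2.2
    (A₀ := AΔ) hA hs₀ hs₁ hs₂ hs₃ hs₃'
    -- axes
    (fun i => by
      rw [incrLhs3_eq, ← hX₀, ← hX₁, ← hX₂, ← hX₃]
      exact (incrPoly3_mono hc0 hX₁0 hX₂0 hX₃0 hAe10 hAe20 (norm_nonneg _) (hne_axis i)).trans hTE)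
    -- normal
    (by
      rw [incrLhs3_eq, ← hX₀, ← hX₁, ← hX₂, ← hX₃]
      exact (incrPoly3_mono hc0 hX₁0 hX₂0 hX₃0 hAn10 hAn20 (norm_nonneg _) hne_n).trans hTN)
    -- along `v`, second order
    (by
      rw [incrLhs2_eq, ← hX₀, ← hX₁, ← hX₂]
      exact (incrPoly2_mono hc0 hX₁0 hX₂0 hAv10 (norm_nonneg _) hne).trans hTV2)
    -- along `v`, third order
    (by
      rw [incrLhs3_eq, ← hX₀, ← hX₁, ← hX₂, ← hX₃]
      exact (incrPoly3_mono hc0 hX₁0 hX₂0 hX₃0 hAv10 hAv20 (norm_nonneg _) hne).trans hTV3)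
  -- identify the symbol and compare the weight constant and the support count
  have hLHS : ∀ q : TorusSite 1 (2 * M) × TorusSite 2 L,
      bgmFatMultiplier L M e₀ β (nambuXiCT L μ K) (m + 1) ω (⟨(q.1 0).val, ZMod.val_lt (q.1 0)⟩, q.2) *
        bgmFatMultiplier L M e₀ β (nambuXiCT L μ K) (m + 1) ω' (⟨(q.1 0).val, ZMod.val_lt (q.1 0)⟩, q.2) *
        (sliceSymbolFnXi (β * (L : ℝ) ^ 2) 0 Λ Λ' (matsubaraFreq β M ⟨(q.1 0).val, ZMod.val_lt (q.1 0)⟩) (nambuXiCT L μ K' q.2) -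
          sliceSymbolFnXi (β * (L : ℝ) ^ 2) 0 Λ Λ' (matsubaraFreq β M ⟨(q.1 0).val, ZMod.val_lt (q.1 0)⟩) (nambuXiCT L μ K q.2)) =
      Gs q * (sliceSymbolFnXi (β * (L : ℝ) ^ 2) 0 Λ Λ' (matsubaraFreq β M ⟨(q.1 0).val, ZMod.val_lt (q.1 0)⟩) (nambuXiCT L μ K' q.2) -
          sliceSymbolFnXi (β * (L : ℝ) ^ 2) 0 Λ Λ' (matsubaraFreq β M ⟨(q.1 0).val, ZMod.val_lt (q.1 0)⟩) (nambuXiCT L μ K q.2)) := by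
    intro q; rw [hGsdef]
  simp_rw [hLHS]
  intro z₁
  refine (hmain z₁).trans ?_
  have hAΔ0 : 0 ≤ AΔ := by rw [hAΔ']; positivity
  have hvpos : 0 < Real.sqrt ((v 0 : ℝ) ^ 2 + (v 1 : ℝ) ^ 2) := lt_of_lt_of_le (by linarith only [hNr]) hvlen
  have hNr1 : 0 < Nr - 1 := by linarith only [hNr]
  have hW : 524288 * (1 / s₀ + 1) *
        ((1 + 2 * Real.sqrt 2 * s₁ / (s₂ * Real.sqrt ((v 0 : ℝ) ^ 2 + (v 1 : ℝ) ^ 2)) +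
            2 * Real.sqrt 2 * s₁ / (s₃' * Real.sqrt ((v 0 : ℝ) ^ 2 + (v 1 : ℝ) ^ 2))) ^ 2 *
          ((2 * Real.sqrt 2 / (s₂ * Real.sqrt ((v 0 : ℝ) ^ 2 + (v 1 : ℝ) ^ 2)) + 2) *
            (2 * Real.sqrt 2 / (s₃ * Real.sqrt ((v 0 : ℝ) ^ 2 + (v 1 : ℝ) ^ 2)) + 2))
          + (1 / s₁ + 1) ^ 2 / (1 + s₁ * R₀)) ≤
      524288 * (1 / s₀ + 1) *
        ((1 + 2 * Real.sqrt 2 * s₁ / (s₂ * (Nr - 1)) + 2 * Real.sqrt 2 * s₁ / (s₃' * (Nr - 1))) ^ 2 *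
          ((2 * Real.sqrt 2 / (s₂ * (Nr - 1)) + 2) * (2 * Real.sqrt 2 / (s₃ * (Nr - 1)) + 2))
          + (1 / s₁ + 1) ^ 2 / (1 + s₁ * R₀)) := by
    have h2 : 2 * Real.sqrt 2 / (s₂ * Real.sqrt ((v 0 : ℝ) ^ 2 + (v 1 : ℝ) ^ 2)) ≤ 2 * Real.sqrt 2 / (s₂ * (Nr - 1)) :=
      div_le_div_of_nonneg_left (by positivity) (by positivity) (mul_le_mul_of_nonneg_left hvlen hs₂.le)
    have h3 : 2 * Real.sqrt 2 / (s₃ * Real.sqrt ((v 0 : ℝ) ^ 2 + (v 1 : ℝ) ^ 2)) ≤ 2 * Real.sqrt 2 / (s₃ * (Nr - 1)) :=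
      div_le_div_of_nonneg_left (by positivity) (by positivity) (mul_le_mul_of_nonneg_left hvlen hs₃.le)
    have h4 : 2 * Real.sqrt 2 * s₁ / (s₂ * Real.sqrt ((v 0 : ℝ) ^ 2 + (v 1 : ℝ) ^ 2)) ≤ 2 * Real.sqrt 2 * s₁ / (s₂ * (Nr - 1)) :=
      div_le_div_of_nonneg_left (by positivity) (by positivity) (mul_le_mul_of_nonneg_left hvlen hs₂.le)
    have h5 : 2 * Real.sqrt 2 * s₁ / (s₃' * Real.sqrt ((v 0 : ℝ) ^ 2 + (v 1 : ℝ) ^ 2)) ≤ 2 * Real.sqrt 2 * s₁ / (s₃' * (Nr - 1)) :=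
      div_le_div_of_nonneg_left (by positivity) (by positivity) (mul_le_mul_of_nonneg_left hvlen hs₃'.le)
    have h20 : 0 ≤ 2 * Real.sqrt 2 / (s₂ * Real.sqrt ((v 0 : ℝ) ^ 2 + (v 1 : ℝ) ^ 2)) := by positivity
    have h30 : 0 ≤ 2 * Real.sqrt 2 / (s₃ * Real.sqrt ((v 0 : ℝ) ^ 2 + (v 1 : ℝ) ^ 2)) := by positivity
    have h40 : 0 ≤ 1 + 2 * Real.sqrt 2 * s₁ / (s₂ * Real.sqrt ((v 0 : ℝ) ^ 2 + (v 1 : ℝ) ^ 2)) +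
        2 * Real.sqrt 2 * s₁ / (s₃' * Real.sqrt ((v 0 : ℝ) ^ 2 + (v 1 : ℝ) ^ 2)) := by positivity
    gcongr
  have hcardR : 24 * (L : ℝ) ^ 2 * (Nsp : ℝ) ≤
      24 * (L : ℝ) ^ 2 * ((Real.sqrt 2 * L * ((klScale e₀ m + (4 + 4 * A) * ρf ^ 2) / (2 * B.rhomin - 4 * A)) / π + 2) *
        (Real.sqrt 2 * L * (2 * ρf) / π + 2)) := mul_le_mul_of_nonneg_left hNsple (by positivity)
  have hin0 : 0 ≤ Real.sqrt (524288 * (1 / s₀ + 1) *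
          ((1 + 2 * Real.sqrt 2 * s₁ / (s₂ * (Nr - 1)) + 2 * Real.sqrt 2 * s₁ / (s₃' * (Nr - 1))) ^ 2 *
            ((2 * Real.sqrt 2 / (s₂ * (Nr - 1)) + 2) * (2 * Real.sqrt 2 / (s₃ * (Nr - 1)) + 2))
            + (1 / s₁ + 1) ^ 2 / (1 + s₁ * R₀))) *
        Real.sqrt (24 * (L : ℝ) ^ 2 *
            ((Real.sqrt 2 * L * ((klScale e₀ m + (4 + 4 * A) * ρf ^ 2) / (2 * B.rhomin - 4 * A)) / π + 2) *
              (Real.sqrt 2 * L * (2 * ρf) / π + 2))) * AΔ := by positivity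
  calc (Nt : ℝ) * (Real.sqrt (524288 * (1 / s₀ + 1) *
          ((1 + 2 * Real.sqrt 2 * s₁ / (s₂ * Real.sqrt ((v 0 : ℝ) ^ 2 + (v 1 : ℝ) ^ 2)) +
              2 * Real.sqrt 2 * s₁ / (s₃' * Real.sqrt ((v 0 : ℝ) ^ 2 + (v 1 : ℝ) ^ 2))) ^ 2 *
            ((2 * Real.sqrt 2 / (s₂ * Real.sqrt ((v 0 : ℝ) ^ 2 + (v 1 : ℝ) ^ 2)) + 2) *
              (2 * Real.sqrt 2 / (s₃ * Real.sqrt ((v 0 : ℝ) ^ 2 + (v 1 : ℝ) ^ 2)) + 2))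
            + (1 / s₁ + 1) ^ 2 / (1 + s₁ * R₀))) *
        Real.sqrt (24 * (L : ℝ) ^ 2 * Nsp) * AΔ)
      ≤ (Nt : ℝ) * (Real.sqrt (524288 * (1 / s₀ + 1) *
          ((1 + 2 * Real.sqrt 2 * s₁ / (s₂ * (Nr - 1)) + 2 * Real.sqrt 2 * s₁ / (s₃' * (Nr - 1))) ^ 2 *
            ((2 * Real.sqrt 2 / (s₂ * (Nr - 1)) + 2) * (2 * Real.sqrt 2 / (s₃ * (Nr - 1)) + 2))
            + (1 / s₁ + 1) ^ 2 / (1 + s₁ * R₀))) *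
        Real.sqrt (24 * (L : ℝ) ^ 2 *
            ((Real.sqrt 2 * L * ((klScale e₀ m + (4 + 4 * A) * ρf ^ 2) / (2 * B.rhomin - 4 * A)) / π + 2) *
              (Real.sqrt 2 * L * (2 * ρf) / π + 2))) * AΔ) := by
        gcongr
    _ ≤ _ := mul_le_mul_of_nonneg_right hNtle hin0

end PairBound

end Summit.HubbardSuperconductivity.HubbardSuperconductivity.Theorems.TorusFourierL2

end
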